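import Summits.RiemannHypothesis.RiemannHypothesis.Theorems.TiltedLandingLaw421R3LandingDoor
import Summits.RiemannHypothesis.RiemannHypothesis.Theorems.TiltedLandingLaw421R3RateSplit
import Summits.RiemannHypothesis.RiemannHypothesis.Theorems.TiltedLandingLaw421R3RealCritClose
import Summits.RiemannHypothesis.RiemannHypothesis.Theorems.TiltedLandingLaw421R3PairFieldSign
import Summits.RiemannHypothesis.RiemannHypothesis.Theses.EarlyAppointments

/-! # Lens-1 COVERAGE THEOREM (file A of 2: §1–§11 + §13b.1–3) for the SUCC law of record `RhW08.LandingDoor.DoorAvailLawQ8` (crux ⟨33346⟩ `TiltedLandingLaw421R`)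

Landable cut (director (CA446)(3′)) of the lens-1 workfile `Cruxes/TiltedLandingLaw421R/Lens1_Coverage.lean` (Coverage-v2, e87959b0c0079a43):
its §4 and §6–§14 INCLUDING the v2 section §13b (the Jensen dip lemma, proved), with §15 (the sorried candidate stubs) DELETED, plus the
landable helpers of the lens-1 Sketch v8 that were not yet in the tree (§1 J2 socket + door; `realField_im_neg`, `band_collar`).  Already-landed
lens-1 lemmas are referenced by name and not re-declared: `RhW08.Lens1.pairField_im_pos_iff` (here only the corollary `pairField_im_pos_iff'`
without the binder `c.im ≠ 0`), `RhW08.Lens1.newtonChild_mem_disc_iff` (docstrings only).  Namespace `RhW08.Lens1Coverage`.  0 sorry.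

## Contents
* §1 J2 (two-circle pinned count) socket `ClusterNumbersJ2` + door `succ_of_clusterNumbersJ2` (helper; CA441: not a law-of-record door).
* §2 sign helpers: `pairField_im_pos_iff'`, `realField_im_neg`, `band_collar`.
* §4 door N♯ (`NewtonNumbersSharp`, `succ_of_newtonNumbersSharp`), §6 regime observables (`coverIndex` ι, `fieldStrength` κ, …), §7 door N♭
  (`NewtonNumbersChild`, `succ_of_newtonNumbersChild`), §8 END number under separation, §9–§10 piece R (roof localisation) with the sign
  identity (S1) `coverIndexPairSum_of_frame` PROVED, §11 Newton-scale numbers (`endNumber`, `NewtonSep`, `ChildCornerSlack`).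
* §12 THE CELLS `CellCov/CellF/CellNb/CellL/CellE` (+ `LandingDip`) and the tautology `cells_cover`.
* §13 regime lemmas: `regime_F`, `regime_Nb` PROVED (successor currency); open regime statements `RegCov8/RegF8/RegNb8/RegL8/RegE8` (Q8-door
  currency; `doorAvailLawQ8_implies_regimes`); §13b THE JENSEN DIP LEMMA `jensenDip`/`jensenDip_pos` (real-axis dual of
  `Literature.Analysis.Complex.jensen_circle`) and `succ_of_dip_deep`/`regime_Ldeep` PROVED; `LandingDipDeep`, open `RegLedge8`.
* §14 compositions (sorry-free): `doorAvailLawQ8_of_regimes` (literal), `antiEscapeCore_of_regimes`, `TiltedLandingLaw421R_of_regimes :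
  RegCov8 → RegL8 → RegE8 → RhW08.RateSplit.RateLawsHalfQ → …TiltedLandingLaw421R` (v7q composition of record, CA446 D1), and the v2
  refinement `TiltedLandingLaw421R_of_regimes2 : RegCov8 → RegLedge8 → RegE8 → RateLawsHalfQ → …` (cell L split, deep part proved).

Nothing here bears on the truth of RH; RH is not proved; the crux ⟨33346⟩ stays OPEN (the open regime statements are hypotheses). -/

namespace RhW08.Lens1Coverage


set_option linter.dupNamespace false

open Complex Set
open scoped ComplexConjugate
open Literature.Analysis.Complex
open Summit.RiemannHypothesis.RiemannHypothesis.Theorems.Splittings.JensenWindow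
open RhIdea6.G17.W07C7 RhIdea6.G17.W07C7.Rev6 RhIdea6.G18.W07C8.Law421BirthS RhIdea6.G19.W07C11.Seam
open RhIdea6.G20.W07C12.Frac RhIdea6.G20.W07C12.StColP RhW07.C12.FieldSplit RhIdea6.G21.W07C13.TentMax
open RhW07.C14.TwoSided RhW07.C14.Classes RhW07.C14.Lineage RhW07.C14.Booking
open RhW07.C13.Heredity RhIdea6.G22.W07C15pre.Injection RhW07.E3.Cell RhW07.E3.Lit
open RhW08.Round1 RhW08.StSwap RhW08.Round2 RhW08.QuadW RhW08.SealSwapQ RhW08.SealSwap RhW08.SuccB RhW08.SuccSplit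
open RhW08.SuccTheft RhW08.Column RhW08.Hurwitz RhW08.ClusterQ RhW08.ClusterQM RhW08.NewtonDoor RhW08.NewtonDoorGenusOne RhW08.PurseP
open RhW08.AntiEscapeSplit7

/-! ## §1 (from Sketch v8 §1; helper, NOT a law-of-record door — CA441, K-B2) Idea `two-circle-pinned-count`: pin on the outer disc,
certify on an inner real-centred circle -/

/-- SOCKET «cluster, level-`j`, pinned OUTER ⁄ certified INNER» (all data level-`j`).  OUTER disc `D̄(a, ρ)`, `a` real,
`ρ ≤ Hs` (anti-absorption cap: the far cofactor `h` still carries every zero farther than `Hs` from `a`), the zero list `S`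
CONFINED to it and COMPLETE in it (`h ≠ 0` on the closed outer disc); INNER circle `‖z − a'‖ = ρ'`, `a'` real,
`|a' − a| + ρ' ≤ ρ`; the COUNT `zcountNReal F a' ρ' + 2 ≤ zcountN M a' ρ'`, the DEPTH clause and the FIELD-VARIATION
inequality `‖Q‖·‖h′ − K h‖ < ‖M‖·‖h‖` are all read on the INNER circle (`F := f^{(j)}`, `Q := nearPoly S m`, `M := tiltModel S m K`).
With `(a', ρ') = (a, ρ)` this is `ClusterNumbersJ'` plus the cap; the gain is that the successor is CHARGED AT THE INNER RADIUS
(the child's own height scale), not at the outer radius that must swallow the roof. -/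
def ClusterNumbersJ2 (f : ℂ → ℂ) (x₀ R Hs : ℝ) (j : ℕ) : Prop :=
  ∃ (S : Finset ℂ) (m : ℂ → ℕ) (K : ℂ) (h : ℂ → ℂ) (a ρ a' ρ' : ℝ), 0 < ρ' ∧ ρ ≤ Hs ∧ |a' - a| + ρ' ≤ ρ ∧
    (∀ u ∈ S, ‖u - (a : ℂ)‖ ≤ ρ) ∧
    Differentiable ℂ h ∧
    (∀ z : ℂ, iteratedDeriv j f z = (nearPoly S m).eval z * h z) ∧
    (∀ z : ℂ, ‖z - (a : ℂ)‖ ≤ ρ → h z ≠ 0) ∧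
    (|a' - x₀| + ρ' ≤ R / 2 ∨ (max (|a' - x₀| + ρ' - R / 2) 0) ^ 2 + ((j : ℝ) + 1) * ρ' ^ 2 ≤ ((j : ℝ) + 1) * Hs ^ 2) ∧
    zcountNReal (iteratedDeriv j f) a' ρ' + 2 ≤ zcountN (fun z => (tiltModel S m K).eval z) a' ρ' ∧
    ∀ z : ℂ, ‖z - (a' : ℂ)‖ = ρ' →
      ‖(nearPoly S m).eval z‖ * ‖deriv h z - K * h z‖ < ‖(tiltModel S m K).eval z‖ * ‖h z‖

/-- ★ DOOR from the two-circle socket — PROVED by name from the landed band-deep tilted door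
`RhW08.ClusterQM.tiltClusterLawQB_of_realBound` over the real pigeonhole `RealCritBoundNSig` (closed by name, C4 g29). -/
theorem succ_of_clusterNumbersJ2 (hRB : RealCritBoundNSig) {η : ℝ} {f : ℂ → ℂ} {x₀ s hmax R Hs : ℝ} {B j : ℕ} {v : ℂ}
    (hE : EngineHyps5 2 η f x₀ s hmax R Hs B) (hv : StTrkDQ η f x₀ s hmax R Hs B j v) (hnR : ¬ ReadyR2 η f x₀ s hmax R Hs B j v)
    (hC : ClusterNumbersJ2 f x₀ R Hs j) : ∃ u : ℂ, StTrkDQ η f x₀ s hmax R Hs B (j + 1) u := by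
  obtain ⟨S, m, K, h, a, ρ, a', ρ', hρ', -, hin, -, hh, hfac, hh0, hdepth, hn, hvar⟩ := hC
  have hsub : ∀ z : ℂ, ‖z - (a' : ℂ)‖ ≤ ρ' → ‖z - (a : ℂ)‖ ≤ ρ := by
    intro z hz
    have h1 : ‖z - (a : ℂ)‖ ≤ ‖z - (a' : ℂ)‖ + ‖(a' : ℂ) - (a : ℂ)‖ := by
      have := norm_add_le (z - (a' : ℂ)) ((a' : ℂ) - (a : ℂ))
      rwa [sub_add_sub_cancel] at this
    have h2 : ‖(a' : ℂ) - (a : ℂ)‖ = |a' - a| := by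
      rw [← Complex.ofReal_sub, Complex.norm_real, Real.norm_eq_abs]
    linarith
  refine tiltClusterLawQB_of_realBound hRB hE hv hnR hρ' hdepth
    ⟨fun z => (nearPoly S m).eval z, h, fun z => (tiltModel S m K).eval z, Polynomial.differentiable _, hh,
      Polynomial.differentiable _, hfac, fun z hz => hh0 z (hsub z hz), rfl, fun z hz => ?_⟩ hn
  exact (variation_iff_domination K hh hfac z).mp (hvar z hz)

/-- The v7 socket is the diagonal case of the two-circle socket (under the cap `ρ ≤ Hs`). -/
theorem clusterNumbersJ2_of_J' {f : ℂ → ℂ} {x₀ R Hs : ℝ} {j : ℕ}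
    (hC : ∃ (S : Finset ℂ) (m : ℂ → ℕ) (K : ℂ) (h : ℂ → ℂ) (a ρ : ℝ), 0 < ρ ∧ ρ ≤ Hs ∧ (∀ u ∈ S, ‖u - (a : ℂ)‖ ≤ ρ) ∧
      Differentiable ℂ h ∧ (∀ z : ℂ, iteratedDeriv j f z = (nearPoly S m).eval z * h z) ∧
      (∀ z : ℂ, ‖z - (a : ℂ)‖ ≤ ρ → h z ≠ 0) ∧
      (|a - x₀| + ρ ≤ R / 2 ∨ (max (|a - x₀| + ρ - R / 2) 0) ^ 2 + ((j : ℝ) + 1) * ρ ^ 2 ≤ ((j : ℝ) + 1) * Hs ^ 2) ∧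
      zcountNReal (iteratedDeriv j f) a ρ + 2 ≤ zcountN (fun z => (tiltModel S m K).eval z) a ρ ∧
      ∀ z : ℂ, ‖z - (a : ℂ)‖ = ρ →
        ‖(nearPoly S m).eval z‖ * ‖deriv h z - K * h z‖ < ‖(tiltModel S m K).eval z‖ * ‖h z‖) :
    ClusterNumbersJ2 f x₀ R Hs j := by
  obtain ⟨S, m, K, h, a, ρ, hρ, hcap, hS, hh, hfac, hh0, hdepth, hn, hvar⟩ := hC
  exact ⟨S, m, K, h, a, ρ, a, ρ, hρ, hcap, by simp, hS, hh, hfac, hh0, hdepth, hn, hvar⟩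

/-! ## §2a FLOOR TERM SIGN and BAND COLLAR (from Sketch v8 §2) -/

/-- FLOOR TERM SIGN: a real zero `x` pushes the field at `v` DOWNWARD (inward), by `−Im v/‖v − x‖²`. -/
theorem realField_im_neg {v : ℂ} (hv : 0 < v.im) (x : ℝ) (hx : (x : ℂ) ≠ v) : ((v - (x : ℂ))⁻¹).im < 0 := by
  have hne : v - (x : ℂ) ≠ 0 := sub_ne_zero.mpr (Ne.symm hx)
  rw [Complex.inv_im, Complex.sub_im, Complex.ofReal_im, sub_zero]
  have hpos : 0 < Complex.normSq (v - (x : ℂ)) := Complex.normSq_pos.mpr hne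
  exact div_neg_of_neg_of_pos (neg_neg_of_pos hv) hpos

/-- BAND COLLAR (exact algebra): a point `w` within `δ` of a level-`j` band point `v` (`(ρ_v)₊² + j·Im v² ≤ j·Hs²`, `0 ≤ Im v ≤ Hs`)
satisfies the level-`(j+1)` band inequality as soon as `δ·(2ρ_v + 2(j+1)·Im v + (j+2)·δ) ≤ Hs² − Im v²` — the collar has width
`≍ (Hs − Im v)/(j+1)`; an `s`-scale displacement cannot leave the band below the top layer while `(j+2)·s ≲ Hs − Im v`. (Proved: algebra.) -/
theorem band_collar {x₀ R Hs : ℝ} {j : ℕ} {v w : ℂ} {δ : ℝ}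
    (hv : (max (|v.re - x₀| - R / 2) 0) ^ 2 + (j : ℝ) * v.im ^ 2 ≤ (j : ℝ) * Hs ^ 2) (hvim : 0 ≤ v.im)
    (hδ : 0 ≤ δ) (hw : ‖w - v‖ ≤ δ)
    (hslack : δ * (2 * max (|v.re - x₀| - R / 2) 0 + 2 * ((j : ℝ) + 1) * v.im + ((j : ℝ) + 2) * δ) ≤ Hs ^ 2 - v.im ^ 2) :
    (max (|w.re - x₀| - R / 2) 0) ^ 2 + ((j : ℝ) + 1) * w.im ^ 2 ≤ ((j : ℝ) + 1) * Hs ^ 2 := by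
  have hre : |w.re - v.re| ≤ δ := le_trans (by simpa using Complex.abs_re_le_norm (w - v)) hw
  have him : |w.im - v.im| ≤ δ := le_trans (by simpa using Complex.abs_im_le_norm (w - v)) hw
  set ρv := max (|v.re - x₀| - R / 2) 0 with hρv
  have hρv0 : 0 ≤ ρv := le_max_right _ _
  have hρw : max (|w.re - x₀| - R / 2) 0 ≤ ρv + δ := by
    have h1 : |w.re - x₀| ≤ |v.re - x₀| + δ := by
      have := abs_sub_le (w.re) (v.re) x₀
      linarith [abs_sub_comm w.re v.re]
    refine max_le ?_ (by linarith)
    have := le_max_left (|v.re - x₀| - R / 2) 0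
    linarith
  have hρw0 : 0 ≤ max (|w.re - x₀| - R / 2) 0 := le_max_right _ _
  have hwim : |w.im| ≤ v.im + δ := by
    have := abs_sub_abs_le_abs_sub w.im v.im
    rw [abs_of_nonneg hvim] at this
    linarith
  have hsq1 : (max (|w.re - x₀| - R / 2) 0) ^ 2 ≤ (ρv + δ) ^ 2 := pow_le_pow_left₀ hρw0 hρw 2
  have hsq2 : w.im ^ 2 ≤ (v.im + δ) ^ 2 := by
    have h0 : 0 ≤ |w.im| := abs_nonneg _
    have := pow_le_pow_left₀ h0 hwim 2
    simpa [sq_abs] using this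
  have hj : (0 : ℝ) ≤ (j : ℝ) := Nat.cast_nonneg j
  nlinarith [hsq1, hsq2, hv, hslack, hj, mul_nonneg hj (sub_nonneg.mpr hsq2)]

/-! ## §2b PAIR TERM SIGN corollary (from Sketch v8 §2; the pair-term criterion itself is the tree's `RhW08.Lens1.pairField_im_pos_iff`) -/

/-- Corollary of the tree's `RhW08.Lens1.pairField_im_pos_iff` WITHOUT its binder `c.im ≠ 0`: for a REAL zero `c` the pair term is
`2(v − c)⁻¹`, whose imaginary part is negative, and the cover inequality fails (`c.im ^ 2 = 0`). -/
theorem pairField_im_pos_iff' {v c : ℂ} (hv : 0 < v.im) (h1 : c ≠ v) (h2 : c ≠ conj v) :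
    0 < ((v - c)⁻¹ + (v - conj c)⁻¹).im ↔ (v.re - c.re) ^ 2 + v.im ^ 2 < c.im ^ 2 := by
  by_cases hc : c.im = 0
  · have hcc : conj c = c := Complex.conj_eq_iff_im.mpr hc
    have hcr : ((c.re : ℝ) : ℂ) = c := Complex.ext (by simp) (by simp [hc])
    have hneg : ((v - c)⁻¹).im < 0 := by
      have h := realField_im_neg hv c.re (by rw [hcr]; exact h1)
      rwa [hcr] at h
    rw [hcc]
    constructor
    · intro h
      rw [Complex.add_im] at h
      linarith
    · intro h
      rw [hc] at h
      nlinarith [sq_nonneg (v.re - c.re), mul_pos hv hv]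
  · exact RhW08.Lens1.pairField_im_pos_iff hv hc h1 h2

/-! ## §4 Door N♯ (idea `signed-jensen-floor`, typed consequence of (I2)): the Newton door with the scalar slack N5 AND the
regime clause `1 < ‖K‖·Im v` both REPLACED by ONE geometric clause — the Newton disc lies inside `v`'s own closed Jensen disc
`D̄(Re v, Im v)`; band membership of the successor is then Jensen nesting (`RhW08.QuadW.band_of_hang`), charged at the CHILD's
position, not at `Im v + (1+ρ₀)/‖K‖`.  By (I2) the clause is the un-roofed ⁄ floor-dominant regime `Im K_ext ≤ −(margin)`. -/

/-- The Newton door chain of `RhW08.NewtonDoor` with the WHOLE-DISC band clause `hdisc` kept abstract (Lipschitz form). -/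
theorem succ_of_newton_door_lip_disc {η : ℝ} {f : ℂ → ℂ} {x₀ s hmax R Hs : ℝ} {B j : ℕ} {v : ℂ}
    (hE : EngineHyps5 2 η f x₀ s hmax R Hs B) (hv : StTrkDQ η f x₀ s hmax R Hs B j v) {K : ℂ} (hK : K ≠ 0)
    {ρ₀ Λ : ℝ} (hρ₀ : 0 < ρ₀) (hΛ : (1 + ρ₀) * Λ < ρ₀ * ‖K‖) (hoff : ρ₀ / ‖K‖ ≤ |(v - K⁻¹).im|)
    (hh0 : ∀ z : ℂ, ‖z - (v - K⁻¹)‖ ≤ ρ₀ / ‖K‖ → dslope (iteratedDeriv j f) v z ≠ 0)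
    (hlip : ∀ z : ℂ, ‖z - (v - K⁻¹)‖ = ρ₀ / ‖K‖ →
      ‖deriv (dslope (iteratedDeriv j f) v) z / dslope (iteratedDeriv j f) v z - K‖ ≤ Λ)
    (hdisc : ∀ z : ℂ, ‖z - (v - K⁻¹)‖ < ρ₀ / ‖K‖ → |z.im| ≤ Hs →
      (max (|z.re - x₀| - R / 2) 0) ^ 2 + ((j : ℝ) + 1) * z.im ^ 2 ≤ ((j : ℝ) + 1) * Hs ^ 2) :
    ∃ u : ℂ, StTrkDQ η f x₀ s hmax R Hs B (j + 1) u :=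
  succ_of_newton_door' hE hv hK hρ₀ hoff hh0 (fieldVariation_of_lipschitz hK hΛ hh0 hlip) hdisc

/-- Two-point form with `hdisc`. -/
theorem succ_of_newton_door_twoPointU_disc {η : ℝ} {f : ℂ → ℂ} {x₀ s hmax R Hs : ℝ} {B j : ℕ} {v : ℂ}
    (hE : EngineHyps5 2 η f x₀ s hmax R Hs B) (hv : StTrkDQ η f x₀ s hmax R Hs B j v) {K : ℂ} (hK : K ≠ 0)
    {ρ₀ : ℝ} (hρ₀ : 0 < ρ₀) (hoff : ρ₀ / ‖K‖ ≤ |(v - K⁻¹).im|)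
    {ι : Type*} (a : ι → ℂ) (m : ι → ℝ) (hm : ∀ i, 0 ≤ m i)
    (hzeros : ∀ z, dslope (iteratedDeriv j f) v z = 0 → ∃ i, z = a i)
    (hineq : ∀ z : ℂ, ‖z - (v - K⁻¹)‖ = ρ₀ / ‖K‖ →
      ‖deriv (dslope (iteratedDeriv j f) v) z / dslope (iteratedDeriv j f) v z - K‖ ≤ ‖z - v‖ * ∑' i, m i / (‖z - a i‖ * ‖v - a i‖))
    (hSv : Summable fun i => m i / (‖v - a i‖ * ‖v - a i‖))
    {δ : ℝ} (hδ : 0 < δ) (hsep : ∀ i, (1 + ρ₀) / ‖K‖ + δ ≤ ‖v - a i‖)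
    (hend : (1 + ρ₀) * ((1 + ρ₀) / ‖K‖ * ∑' i, m i / ((‖v - a i‖ - (1 + ρ₀) / ‖K‖) * ‖v - a i‖)) < ρ₀ * ‖K‖)
    (hdisc : ∀ z : ℂ, ‖z - (v - K⁻¹)‖ < ρ₀ / ‖K‖ → |z.im| ≤ Hs →
      (max (|z.re - x₀| - R / 2) 0) ^ 2 + ((j : ℝ) + 1) * z.im ^ 2 ≤ ((j : ℝ) + 1) * Hs ^ 2) :
    ∃ u : ℂ, StTrkDQ η f x₀ s hmax R Hs B (j + 1) u := by
  have hKn : 0 < ‖K‖ := norm_pos_iff.mpr hK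
  have hrN : 0 ≤ (1 + ρ₀) / ‖K‖ := by positivity
  have hsep' : ∀ i, 0 < m i → (1 + ρ₀) / ‖K‖ < ‖v - a i‖ := fun i _ => by linarith [hsep i]
  have hh0 : ∀ z : ℂ, ‖z - (v - K⁻¹)‖ ≤ ρ₀ / ‖K‖ → dslope (iteratedDeriv j f) v z ≠ 0 := by
    intro z hz hz0
    obtain ⟨i, rfl⟩ := hzeros z hz0
    have h1 : ‖a i - v‖ ≤ (1 + ρ₀) / ‖K‖ := norm_sub_le_of_newtonDisc hK hz
    have h2 := hsep i
    rw [norm_sub_rev] at h2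
    linarith
  have hS := summable_majorant_of_uniform_sep a m hm hrN hδ (fun i _ => hsep i) hSv
  refine succ_of_newton_door_lip_disc hE hv hK hρ₀ hend hoff hh0 ?_ hdisc
  intro z hz
  exact le_trans (hineq z hz) (tsum_twoPoint_le a m hm (norm_sub_le_of_newtonDisc hK (le_of_eq hz)) hsep' hS)

/-- Genus-one primitive-data form with `hdisc` (body = `RhW08.NewtonDoorGenusOne.succ_of_newton_door_genusOne`, last line changed). -/
theorem succ_of_newton_door_genusOne_disc {η : ℝ} {f : ℂ → ℂ} {x₀ s hmax R Hs : ℝ} {B j : ℕ} {v : ℂ}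
    (hE : EngineHyps5 2 η f x₀ s hmax R Hs B) (hv : StTrkDQ η f x₀ s hmax R Hs B j v)
    {C ρ : ℝ} (hFd : Differentiable ℂ (iteratedDeriv j f))
    (hgrowth : ∀ z, ‖iteratedDeriv j f z‖ ≤ C * Real.exp (‖z‖ ^ ρ)) (hρ : ρ < 2)
    (hFv : iteratedDeriv j f v = 0) (hsimple : analyticOrderAt (iteratedDeriv j f) v = 1)
    {K : ℂ} (hKdef : K = deriv (dslope (iteratedDeriv j f) v) v / dslope (iteratedDeriv j f) v v)
    (hK : K ≠ 0) {ρ₀ : ℝ} (hρ₀ : 0 < ρ₀) (hoff : ρ₀ / ‖K‖ ≤ |(v - K⁻¹).im|)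
    {δ : ℝ} (hδ : 0 < δ)
    (hsepZ : ∀ c, dslope (iteratedDeriv j f) v c = 0 → (1 + ρ₀) / ‖K‖ + δ ≤ ‖v - c‖)
    (hendZ : (1 + ρ₀) * ((1 + ρ₀) / ‖K‖ * ∑' c : ℂ, (analyticOrderNatAt (dslope (iteratedDeriv j f) v) c : ℝ) /
        ((‖v - c‖ - (1 + ρ₀) / ‖K‖) * ‖v - c‖)) < ρ₀ * ‖K‖)
    (hdisc : ∀ z : ℂ, ‖z - (v - K⁻¹)‖ < ρ₀ / ‖K‖ → |z.im| ≤ Hs →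
      (max (|z.re - x₀| - R / 2) 0) ^ 2 + ((j : ℝ) + 1) * z.im ^ 2 ≤ ((j : ℝ) + 1) * Hs ^ 2) :
    ∃ u : ℂ, StTrkDQ η f x₀ s hmax R Hs B (j + 1) u := by
  obtain ⟨ι, a, m, hm, haF, hm1, hcard, hfiber, hzeros, hEnd, htwo⟩ :=
    GenusOneLogDerivC3g41.twoPoint_bound_dslope hFd hgrowth hρ hFv hsimple
  have hv0 : dslope (iteratedDeriv j f) v v ≠ 0 := by
    rw [dslope_same]
    exact Literature.Barriers.RiemannHypothesis.deriv_ne_zero_of_analyticOrderAt_eq_one (hFd.analyticAt v) hsimple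
  have ha0 : ∀ i, dslope (iteratedDeriv j f) v (a i) = 0 := by
    intro i
    obtain ⟨hz, hne⟩ := haF i
    rw [dslope_of_ne _ hne, slope_def_field, hz, hFv, sub_zero, zero_div]
  have hsep : ∀ i, (1 + ρ₀) / ‖K‖ + δ ≤ ‖v - a i‖ := fun i ↦ hsepZ (a i) (ha0 i)
  have hKn : 0 < ‖K‖ := norm_pos_iff.2 hK
  have hcirc : ∀ z : ℂ, ‖z - (v - K⁻¹)‖ = ρ₀ / ‖K‖ → dslope (iteratedDeriv j f) v z ≠ 0 := by
    intro z hz hz0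
    have h1 : (1 + ρ₀) / ‖K‖ + δ ≤ ‖v - z‖ := hsepZ z hz0
    have h2 : ‖v - z‖ ≤ ρ₀ / ‖K‖ + 1 / ‖K‖ := by
      calc ‖v - z‖ = ‖(v - K⁻¹ - z) + K⁻¹‖ := by congr 1; ring
        _ ≤ ‖v - K⁻¹ - z‖ + ‖K⁻¹‖ := norm_add_le _ _
        _ = ρ₀ / ‖K‖ + 1 / ‖K‖ := by rw [norm_sub_rev, hz, norm_inv, one_div]
    have h3 : ρ₀ / ‖K‖ + 1 / ‖K‖ = (1 + ρ₀) / ‖K‖ := by rw [add_div, add_comm]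
    linarith
  have hzeros' : ∀ z, dslope (iteratedDeriv j f) v z = 0 → ∃ i, z = a i :=
    fun z hz ↦ (hzeros z hz).imp fun i hi ↦ hi.1
  have hineq : ∀ z : ℂ, ‖z - (v - K⁻¹)‖ = ρ₀ / ‖K‖ →
      ‖deriv (dslope (iteratedDeriv j f) v) z / dslope (iteratedDeriv j f) v z - K‖ ≤
        ‖z - v‖ * ∑' i, m i / (‖z - a i‖ * ‖v - a i‖) := by
    intro z hz
    rw [hKdef]
    exact (htwo z v (hcirc z hz) hv0).2
  have hSv : Summable fun i ↦ m i / (‖v - a i‖ * ‖v - a i‖) := (htwo v v hv0 hv0).1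
  have hs1 : Summable fun i ↦ m i / ((‖v - a i‖ - (1 + ρ₀) / ‖K‖) * ‖v - a i‖) :=
    hEnd ((1 + ρ₀) / ‖K‖) (by positivity) (fun i ↦ by linarith [hsep i])
  have hs2 : Summable fun i ↦ m i * (1 / ((‖v - a i‖ - (1 + ρ₀) / ‖K‖) * ‖v - a i‖)) :=
    hs1.congr fun i ↦ by ring
  have h3 := (hfiber (fun c ↦ 1 / ((‖v - c‖ - (1 + ρ₀) / ‖K‖) * ‖v - c‖)) hs2).tsum_eq
  have hEq : ∑' i, m i / ((‖v - a i‖ - (1 + ρ₀) / ‖K‖) * ‖v - a i‖) =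
      ∑' c : ℂ, (analyticOrderNatAt (dslope (iteratedDeriv j f) v) c : ℝ) /
        ((‖v - c‖ - (1 + ρ₀) / ‖K‖) * ‖v - c‖) := by
    rw [show (fun i ↦ m i / ((‖v - a i‖ - (1 + ρ₀) / ‖K‖) * ‖v - a i‖)) =
        fun i ↦ m i * (1 / ((‖v - a i‖ - (1 + ρ₀) / ‖K‖) * ‖v - a i‖)) from funext fun i ↦ by ring, ← h3]
    exact tsum_congr fun c ↦ by ring
  have hend : (1 + ρ₀) * ((1 + ρ₀) / ‖K‖ *
      ∑' i, m i / ((‖v - a i‖ - (1 + ρ₀) / ‖K‖) * ‖v - a i‖)) < ρ₀ * ‖K‖ := by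
    rw [hEq]
    exact hendZ
  exact succ_of_newton_door_twoPointU_disc hE hv hK hρ₀ hoff a m hm hzeros' hineq hSv hδ hsep hend hdisc

/-- NEWTON NUMBERS♯ with data `(K, ρ₀, δ)`: N1 `K ≠ 0`, N3 off-axis, N4 separation + END number — and, replacing BOTH the regime clause
`1 < ‖K‖·Im v` and the scalar slack N5, the JENSEN-DISC CLAUSE `‖(v − K⁻¹) − Re v‖ + ρ₀/‖K‖ ≤ Im v` (the closed Newton disc inside `v`'s own
closed Jensen disc).  FRAME-FREE: no `x₀, R, Hs`. By `newtonChild_mem_disc_iff` the centre condition is `Im K_ext ≤ 0`; the clause is its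
version with margin `ρ₀/‖K‖`. -/
def NewtonNumbersSharpWith (f : ℂ → ℂ) (j : ℕ) (v K : ℂ) (ρ₀ δ : ℝ) : Prop :=
  K ≠ 0 ∧ 0 < ρ₀ ∧ ρ₀ / ‖K‖ ≤ |(v - K⁻¹).im| ∧ 0 < δ ∧
    (∀ c : ℂ, dslope (iteratedDeriv j f) v c = 0 → (1 + ρ₀) / ‖K‖ + δ ≤ ‖v - c‖) ∧
    (1 + ρ₀) * ((1 + ρ₀) / ‖K‖ * ∑' c : ℂ, (analyticOrderNatAt (dslope (iteratedDeriv j f) v) c : ℝ) /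
        ((‖v - c‖ - (1 + ρ₀) / ‖K‖) * ‖v - c‖)) < ρ₀ * ‖K‖ ∧
    ‖(v - K⁻¹) - (v.re : ℂ)‖ + ρ₀ / ‖K‖ ≤ v.im

/-- ★ SOCKET «Newton♯» at the canonical field value. -/
def NewtonNumbersSharp (f : ℂ → ℂ) (j : ℕ) (v : ℂ) : Prop :=
  ∃ ρ₀ δ : ℝ, NewtonNumbersSharpWith f j v (newtonK f j v) ρ₀ δ

/-- The Jensen-disc clause gives the WHOLE-DISC band clause by Jensen nesting (`band_of_hang`): every point of the open Newton disc is a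
`NestedStep` child of the band state `v`. -/
theorem hdisc_of_jensenDisc {η : ℝ} {f : ℂ → ℂ} {x₀ s hmax R Hs : ℝ} {B j : ℕ} {v K : ℂ} {ρ₀ : ℝ}
    (hv : StTrkDQ η f x₀ s hmax R Hs B j v) (hJ : ‖(v - K⁻¹) - (v.re : ℂ)‖ + ρ₀ / ‖K‖ ≤ v.im) :
    ∀ z : ℂ, ‖z - (v - K⁻¹)‖ < ρ₀ / ‖K‖ → |z.im| ≤ Hs →
      (max (|z.re - x₀| - R / 2) 0) ^ 2 + ((j : ℝ) + 1) * z.im ^ 2 ≤ ((j : ℝ) + 1) * Hs ^ 2 := by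
  intro z hz _
  have hv' : StColQ' η f x₀ s hmax R Hs B j v := hv
  apply band_of_hang hv'
  -- `NestedStep v z`: `(z.re − v.re)² + z.im² ≤ v.im²`
  have h1 : ‖z - (v.re : ℂ)‖ ≤ v.im := by
    calc ‖z - (v.re : ℂ)‖ = ‖(z - (v - K⁻¹)) + ((v - K⁻¹) - (v.re : ℂ))‖ := by congr 1; ring
      _ ≤ ‖z - (v - K⁻¹)‖ + ‖(v - K⁻¹) - (v.re : ℂ)‖ := norm_add_le _ _
      _ ≤ v.im := by linarith
  have hy : 0 ≤ v.im := le_trans (norm_nonneg _) h1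
  have h2 : ‖z - (v.re : ℂ)‖ ^ 2 ≤ v.im ^ 2 := pow_le_pow_left₀ (norm_nonneg _) h1 2
  have h3 : ‖z - (v.re : ℂ)‖ ^ 2 = (z.re - v.re) ^ 2 + z.im ^ 2 := by
    rw [← Complex.normSq_eq_norm_sq, Complex.normSq_apply]
    simp [Complex.sub_re, Complex.sub_im]
    ring
  unfold NestedStep
  linarith [h2, h3]

/-- ★★ DOOR N♯: a legal frame, a band state `v`, and Newton numbers♯ ⇒ the successor state (multiple zero: `succ_of_multiple`; simple zero:
the genus-one engine with the whole-disc clause from `hdisc_of_jensenDisc`).  No `1 < ‖K‖·Im v`, no scalar slack. -/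
theorem succ_of_newtonNumbersSharp {η : ℝ} {f : ℂ → ℂ} {x₀ s hmax R Hs : ℝ} {B j : ℕ} {v : ℂ}
    (hE : EngineHyps5 2 η f x₀ s hmax R Hs B) (hv : StTrkDQ η f x₀ s hmax R Hs B j v) (hN : NewtonNumbersSharp f j v) :
    ∃ u : ℂ, StTrkDQ η f x₀ s hmax R Hs B (j + 1) u := by
  by_cases hz : iteratedDeriv (j + 1) f v = 0
  · exact succ_of_multiple hE hv hz
  obtain ⟨ρ₀, δ, hK, hρ₀, hoff, hδ, hsepZ, hendZ, hJ⟩ := hN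
  have hf : Summit.RiemannHypothesis.RiemannHypothesis.Theorems.Splittings.JensenWindow.RealEntireLt2 f :=
    realEntireLt2_of_hyps hE
  obtain ⟨ρ, C, hρ0, hρ, hgr⟩ := hf.growth
  obtain ⟨ρ', C', -, hρ', hgr'⟩ := Literature.Analysis.Complex.exists_growth_iteratedDeriv hf.diff hρ0 hρ hgr j
  have hFd : Differentiable ℂ (iteratedDeriv j f) := differentiable_iteratedDeriv_of_entire hE.1 j
  have hv' : StColQ' η f x₀ s hmax R Hs B j v := hv
  obtain ⟨-, hFv, -⟩ := hv'
  have hderiv : deriv (iteratedDeriv j f) v ≠ 0 := by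
    rw [← iteratedDeriv_succ]; exact hz
  have hsimple : analyticOrderAt (iteratedDeriv j f) v = 1 :=
    (hFd.analyticAt v).analyticOrderAt_eq_one_of_zero_deriv_ne_zero hFv hderiv
  exact succ_of_newton_door_genusOne_disc hE hv hFd hgr' hρ' hFv hsimple rfl hK hρ₀ hoff hδ hsepZ hendZ
    (hdisc_of_jensenDisc hv hJ)


end RhW08.Lens1Coverage
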